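import Summits.QuantumFields.YangMills.Theorems.BalabanUVNodesN15TwoGridL2Blocks
import HarnessLib

/-!
# Route «BalabanUVNodes», node N15 = NE2, -a lane, part 62: BAŁABAN's (1.114) L² ENTRIES `‖ζ∇GJ‖`, `‖ζ∇G∇*J‖`, `‖ζ∇∇GJ‖` AS L²-BLOCK MAJORANTS OF `∇_μG`, `∇_μG∇*_ν`, `∇_μ∇_νG`
# ON THE N15 CARRIER (`C·e^{−δ₀|y−y′|_T}`, both members of the η-pair of record, ONE constant set) — entry 2 of [B9] (3.42), second file

Cell `pub-ymgap`, seat `pub-ymgap-dag-n15-a` (KNIT-BY-NAME, g13); `--kind proof --supports stmt-QuantumFields-20507 --as helper`.  Over part 61 (`BlockNorm.l2Blocks`) and parts 39∕42 (the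
(1.110) dictionary: `inv_mulVec_ofReal_eq`, `fdiff_mulVec_ofReal`, `star_fdiff_mulVec_ofReal`, `suppInL_vec_of_isLoc`, `suppInL_ten_of_isLoc`, `ineq110_114_pair`).
WHAT.  Bałaban's Proposition 1.2, fifth block (1.114) (verbatim): *"‖ζGJ‖, ‖ζ∇GJ‖, ‖ζG∇*J‖, ‖ζ∇G∇*J‖, ‖ζ∇∇GJ‖, ‖ζG∇*∇*J‖ ≤ O(1)e^{−δ₀|y−y′|}|ζ|‖J‖ for supp ζ ⊂ Δ̃(y), supp J ⊂ Δ̃(y′)"* —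
the tree's theorem `B5Prop12GHolds.prop12_famG_printed` (clause `Ineq110_114 ….2.2.2.2`, concrete setting `latticeSettingP12R`: `l2loc m J ζ = η^{D∕2}·l2locL m J ζ`, `l2Norm J =
η^{D∕2}·locNorm J`) — READ in the L²-block currency of part 61 with the weight `w = etaPow n (d+1) = η^{d+1}` and King's unit blocks: with `ζ = 𝟙_{B(y)}` (`|ζ| ≤ 1`, `supp ζ ⊂ Δ̃(y)`),
`loc_{L²}(y, ρ(sD_μ)∘[ρ(sD_ν)∘]G[∘ρ(n(s_ν⁻¹−1))]f) ≤ ‖ζ(…)J‖ ≤ C e^{−δ₀|y−y′|} ‖J‖ = C e^{−δ₀|y−y′|} loc_{L²}(y′, f)`.  §82 the cut-off `blockCut` and its (1.114) admissibility;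
§83 `hasMajL2_grad_of_ineq` (m = 1), ★ `hasMajL2_gradDivAdj_of_ineq` (m = 3), ★ `hasMajL2_grad2_of_ineq` (m = 4), generic `n`; §84 ★ `hasMajL2_entries114_pair` (both members of the
η-pair of record, one `(δ₀, C)`).
HONEST FRAMING ∕ LIMITS.  Dictionary + bookkeeping over the tree's theorem `prop12_famG_printed`; tori of record in §84; `U ≡ 1`; NO η-rate here (entry 2 is the sequel); count-neutral (typed
28∕28 · discharged 5∕27 of record unchanged); NOT a discharge of N15 (object-bound; NE2⁺ NOT PRINTED); one finite T⁴ at fixed ε — NOT infinite volume, NOT OS on ℝ⁴, NOT a mass gap, NOT Clay.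
-/

noncomputable section

open scoped BigOperators Matrix
open Finset

namespace Summit.QuantumFields.YangMills.BalabanUVNodes.N15.TwoGrid

open Literature.MathematicalPhysics.QuantumFieldTheory.Balaban1983to89
open Literature.MathematicalPhysics.QuantumFieldTheory.Balaban1983to89.B11SectG (BlockNorm HasMaj)
open Literature.MathematicalPhysics.QuantumFieldTheory.Balaban1983to89.B5Prop11Plancherel (Tor fine unitVec fdiff)
open Literature.MathematicalPhysics.QuantumFieldTheory.Balaban1983to89.B5DeltaA169 (DeltaA)
open Literature.MathematicalPhysics.QuantumFieldTheory.Balaban1983to89.B5Prop11Lower (nsq)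
open Literature.MathematicalPhysics.QuantumFieldTheory.Balaban1983to89.B5Prop11Lattice (l2 l2T grad grad2 divT divT2)
open Literature.MathematicalPhysics.QuantumFieldTheory.Balaban1983to89.B5Prop11SettingModel (locNorm)
open Literature.MathematicalPhysics.QuantumFieldTheory.Balaban1983to89.B5Prop12FieldsLattice (cubeT suppInL smulT smulV cutInL cutSupL l2locL)
open Literature.MathematicalPhysics.QuantumFieldTheory.Balaban1983to89.B5SettingP12Real (LocR latticeSettingP12R)
open Literature.MathematicalPhysics.QuantumFieldTheory.Balaban1983to89.B5SettingP12Weighted (sqEta etaPow sqEta_sq etaPow_nonneg sqEta_nonneg)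
open Literature.MathematicalPhysics.QuantumFieldTheory.Balaban1983to89.B5SiteBridgeP12 (MP)
open Literature.MathematicalPhysics.QuantumFieldTheory.Balaban1983to89.LatticeNorms (supNorm supNorm_le supNorm_nonneg)
open Literature.MathematicalPhysics.QuantumFieldTheory.King1986.Torus (blockOf tdistT tdistT_nonneg)
open Literature.MathematicalPhysics.QuantumFieldTheory.Balaban1983to89.B6UnitTorusCarrier (unitTorusGeo)
open Summit.QuantumFields.YangMills.BalabanUVNodes.N15.VectorPiece (blkFine)

variable {d : ℕ}

/-! ## §82 The cut-off `𝟙_{B(y)}` and the L² sizes -/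

section Cut

variable {L : ℕ} (M : Fin (d + 1) → ℕ) [∀ μ, NeZero (M μ)] (k n : ℕ) [NeZero n]

/-- the cut-off `ζ = 𝟙_{B(y)}` of King's unit block (values in `{0, 1}`). [cite: Balaban1984PropagatorsI, Prop. 1.2 (1.114) p.36 (supp ζ ⊂ Δ̃(y))] -/
def blockCut (y : Tor M) (x : Tor (fine n M)) : ℝ := if blockOf n M x = y then 1 else 0

/-- `supp 𝟙_{B(y)} ⊂ Δ̃(y)`. [cite: Balaban1984PropagatorsI, Prop. 1.2 (1.114) p.36] -/
theorem cutInL_blockCut (hn : 1 ≤ n) (y : Tor M) : cutInL n M (blockCut M n y) y := by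
  intro x hx
  have hxy : blockOf n M x = y := by
    by_contra h
    exact hx (by simp [blockCut, h])
  rw [← hxy]
  exact mem_cubeT_blockOf M n hn x

/-- `|𝟙_{B(y)}| ≤ 1`. [cite: Balaban1984PropagatorsI, Prop. 1.2 (1.114) p.36] -/
theorem cutSupL_blockCut_le (y : Tor M) : cutSupL n M (blockCut M n y) ≤ 1 :=
  supNorm_le zero_le_one fun x _ => by
    unfold blockCut
    split_ifs <;> simp

/-- `𝟙_{B(y)}(x)² = [B(x) = y]`. [folklore] -/
theorem blockCut_sq (y : Tor M) (x : Tor (fine n M)) : blockCut M n y x ^ 2 = if blockOf n M x = y then 1 else 0 := by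
  unfold blockCut; split_ifs <;> simp

/-- **THE L²-BLOCK SIZE THROUGH `nsq`**: `loc_{L²,w}(y, u)² = w·nsq(𝟙_{B(y)}·emb u)` for a real 1-form `u`. [folklore] -/
theorem sq_loc_l2Blocks_eq_nsq (w : ℝ) (hw : 0 ≤ w) (y : Tor M) (u : Tor (fine n M) × Fin (d + 1) → ℝ) :
    (BlockNorm.l2Blocks (unitTorusGeo L k M) (fun i : Tor (fine n M) × Fin (d + 1) => blockOf n M i.1) w hw).loc y u ^ 2
      = w * nsq (fun b : Tor (fine n M) × Fin (d + 1) => ((blockCut M n y b.1 : ℝ) : ℂ) * ((u b : ℝ) : ℂ)) := by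
  classical
  rw [sq_loc_l2Blocks hw, nsq]
  congr 1
  rw [← sum_filter_add_sum_filter_not univ (fun b : Tor (fine n M) × Fin (d + 1) => blockOf n M b.1 = y)
    (fun b => ‖((blockCut M n y b.1 : ℝ) : ℂ) * ((u b : ℝ) : ℂ)‖ ^ 2)]
  have h0 : ∑ b ∈ univ.filter (fun b : Tor (fine n M) × Fin (d + 1) => ¬blockOf n M b.1 = y), ‖((blockCut M n y b.1 : ℝ) : ℂ) * ((u b : ℝ) : ℂ)‖ ^ 2 = 0 :=
    sum_eq_zero fun b hb => by rw [mem_filter] at hb; simp [blockCut, hb.2]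
  rw [h0, add_zero]
  refine sum_congr rfl fun b hb => ?_
  rw [mem_filter] at hb
  simp [blockCut, hb.2, Complex.norm_real, sq_abs]

/-- **THE (1.114) SOURCE NORM IS THE L²-BLOCK SIZE**: for a real 1-form `f` vanishing off `B(y′)`, `η^{D∕2}·‖emb f‖ = loc_{L², η^D}(y′, f)`. [folklore] -/
theorem sqEta_mul_l2_eq_loc {f : Tor (fine n M) × Fin (d + 1) → ℝ} {y' : Tor M}
    (hf : ∀ b : Tor (fine n M) × Fin (d + 1), blockOf n M b.1 ≠ y' → f b = 0) :
    sqEta n (d + 1) * l2 (fun b : Tor (fine n M) × Fin (d + 1) => ((f b : ℝ) : ℂ))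
      = (BlockNorm.l2Blocks (unitTorusGeo L k M) (fun i : Tor (fine n M) × Fin (d + 1) => blockOf n M i.1) (etaPow n (d + 1)) (etaPow_nonneg _ _)).loc y' f := by
  classical
  rw [loc_l2Blocks_eq, l2, sqEta, ← Real.sqrt_mul (etaPow_nonneg _ _)]
  congr 1
  congr 1
  rw [nsq, ← sum_filter_add_sum_filter_not univ (fun b : Tor (fine n M) × Fin (d + 1) => blockOf n M b.1 = y') (fun b => ‖((f b : ℝ) : ℂ)‖ ^ 2)]
  have h0 : ∑ b ∈ univ.filter (fun b : Tor (fine n M) × Fin (d + 1) => ¬blockOf n M b.1 = y'), ‖((f b : ℝ) : ℂ)‖ ^ 2 = 0 :=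
    sum_eq_zero fun b hb => by rw [mem_filter] at hb; simp [hf b hb.2]
  rw [h0, add_zero]
  exact sum_congr rfl fun b _ => by rw [Complex.norm_real, Real.norm_eq_abs, sq_abs]

/-- one component of a tensor L² norm is below the whole: `nsq (F s) ≤ (l2T F)²`. [folklore] -/
theorem nsq_le_l2T_sq {S : Type*} [Fintype S] {m : Type*} [Fintype m] (F : S → m → ℂ) (s : S) : nsq (F s) ≤ l2T F ^ 2 := by
  rw [l2T, Real.sq_sqrt (sum_nonneg fun _ _ => B5Prop11Lower.nsq_nonneg _)]
  exact single_le_sum (f := fun s => nsq (F s)) (fun _ _ => B5Prop11Lower.nsq_nonneg _) (mem_univ s)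

end Cut

/-! ## §83 The three L² entries as L²-block majorants (generic lattice) -/

section Entries

variable {L : ℕ} (M : Fin (d + 1) → ℕ) [∀ μ, NeZero (M μ)] (k n : ℕ) [NeZero n] (a : ℝ)

omit [NeZero n] in
/-- the common final step: from `loc(y, T f)² ≤ (η^{D∕2}·X)², `η^{D∕2}·X ≤ C e^{−δ₀d}·1·(η^{D∕2}‖J‖)` and `η^{D∕2}‖J‖ = loc(y′, f)` to the majorant inequality. [folklore] -/
theorem loc_le_of_l2loc {b : BlockNorm (unitTorusGeo L k M) (Tor (fine n M) × Fin (d + 1) → ℝ)} {y y' : Tor M} {v : Tor (fine n M) × Fin (d + 1) → ℝ}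
    {f : Tor (fine n M) × Fin (d + 1) → ℝ} {X N C δ₀ s : ℝ}
    (hC : 0 ≤ C) (hX : 0 ≤ X) (hs : s ≤ 1) (hN : N = b.loc y' f)
    (hsq : b.loc y v ^ 2 ≤ X ^ 2) (hineq : X ≤ C * Real.exp (-(δ₀ * tdistT M y y')) * s * N) :
    b.loc y v ≤ C * Real.exp (-(δ₀ * tdistT M y y')) * b.loc y' f := by
  have hloc0 : 0 ≤ b.loc y v := b.loc_nonneg y v
  have h1 : b.loc y v ≤ X := (pow_le_pow_iff_left₀ hloc0 hX two_ne_zero).mp hsq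
  have hN0 : 0 ≤ N := by rw [hN]; exact b.loc_nonneg y' f
  calc b.loc y v ≤ X := h1
    _ ≤ C * Real.exp (-(δ₀ * tdistT M y y')) * s * N := hineq
    _ ≤ C * Real.exp (-(δ₀ * tdistT M y y')) * 1 * N := by gcongr
    _ = C * Real.exp (-(δ₀ * tdistT M y y')) * b.loc y' f := by rw [mul_one, hN]

/-- **(1.114) ENTRY «∇GJ» IN L²-BLOCK CURRENCY (generic)**: `HasMaj (l2Blocks η^D) (l2Blocks η^D) (ρ(sD_μ n)∘G) (C·e^{−δ₀ tdistT})`. [cite: Balaban1984PropagatorsI, Prop. 1.2 (1.114) p.36] -/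
theorem hasMajL2_grad_of_ineq (hn : 1 ≤ n) {K : ℕ} {C δ₀ : ℝ} {Cα Cε : ℝ → ℝ} {Cαε : ℝ → ℝ → ℝ}
    (H : B5.Ineq110_114 (latticeSettingP12R n M a K) C Cα Cε Cαε δ₀) (hC : 0 ≤ C) (μ : Fin (d + 1)) :
    HasMaj (BlockNorm.l2Blocks (unitTorusGeo L k M) (fun i : Tor (fine n M) × Fin (d + 1) => blockOf n M i.1) (etaPow n (d + 1)) (etaPow_nonneg _ _))
      (BlockNorm.l2Blocks (unitTorusGeo L k M) (fun i : Tor (fine n M) × Fin (d + 1) => blockOf n M i.1) (etaPow n (d + 1)) (etaPow_nonneg _ _))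
      (symbOp M n (sD M n μ n) ∘ₗ gOp M n a) (fun y y' => C * Real.exp (-(δ₀ * tdistT M y y'))) := by
  classical
  intro y' f hf y
  set b := BlockNorm.l2Blocks (unitTorusGeo L k M) (fun i : Tor (fine n M) × Fin (d + 1) => blockOf n M i.1) (etaPow n (d + 1)) (etaPow_nonneg _ _) with hb
  have hsupp : suppInL n M (LocR.vec f).emb y' := suppInL_vec_of_isLoc M k n hn hf
  have h114 := H.2.2.2.2 1 (LocR.vec f) (blockCut M n y) y y' (cutInL_blockCut M n hn y) hsupp
  -- unfold the setting: `l2loc 1 (vec f) ζ = η^{D/2}·l2T (ζ·∇(G emb f))`, `cutSup = cutSupL`, `l2Norm = η^{D/2}·‖emb f‖`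
  have hG : ((DeltaA n M a)⁻¹ *ᵥ fun i => ((f i : ℝ) : ℂ)) = fun i => ((gOp M n a f i : ℝ) : ℂ) := inv_mulVec_ofReal_eq M n a f
  have hgrad : grad n M ((DeltaA n M a)⁻¹ *ᵥ fun i => ((f i : ℝ) : ℂ)) μ = fun b => (((symbOp M n (sD M n μ n) ∘ₗ gOp M n a) f b : ℝ) : ℂ) := by
    funext b; rw [grad, hG, fdiff_mulVec_ofReal, LinearMap.comp_apply]
  have hsq : b.loc y ((symbOp M n (sD M n μ n) ∘ₗ gOp M n a) f) ^ 2 ≤ (sqEta n (d + 1) * l2T (smulT n M (blockCut M n y) (grad n M ((DeltaA n M a)⁻¹ *ᵥ fun i => ((f i : ℝ) : ℂ))))) ^ 2 := by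
    rw [hb, sq_loc_l2Blocks_eq_nsq M k n _ _ y, mul_pow, sqEta_sq]
    refine mul_le_mul_of_nonneg_left ?_ (etaPow_nonneg _ _)
    have hF : smulT n M (blockCut M n y) (grad n M ((DeltaA n M a)⁻¹ *ᵥ fun i => ((f i : ℝ) : ℂ))) μ
        = fun b => ((blockCut M n y b.1 : ℝ) : ℂ) * ((((symbOp M n (sD M n μ n) ∘ₗ gOp M n a) f b : ℝ) : ℂ)) := by
      funext b
      show ((blockCut M n y b.1 : ℝ) : ℂ) * grad n M ((DeltaA n M a)⁻¹ *ᵥ fun i => ((f i : ℝ) : ℂ)) μ b = _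
      rw [hgrad]
    rw [← hF]
    exact nsq_le_l2T_sq _ μ
  refine loc_le_of_l2loc M k n hC (mul_nonneg (sqEta_nonneg _ _) (by unfold l2T; exact Real.sqrt_nonneg _))
    (cutSupL_blockCut_le M n y) (sqEta_mul_l2_eq_loc M k n hf) hsq ?_
  have e : (latticeSettingP12R n M a K).l2loc 1 (LocR.vec f) (blockCut M n y)
      = sqEta n (d + 1) * l2T (smulT n M (blockCut M n y) (grad n M ((DeltaA n M a)⁻¹ *ᵥ fun i => ((f i : ℝ) : ℂ)))) := rfl
  rw [← e, ← distSite_eq_tdistT]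
  exact h114

/-- ★ **(1.114) ENTRY «∇G∇*J» IN L²-BLOCK CURRENCY (generic)**: `HasMaj (l2Blocks η^D) (l2Blocks η^D) (ρ(sD_μ n)∘G∘ρ(n(s_ν⁻¹−1))) (C·e^{−δ₀ tdistT})` — the tensor source
`J_{ν′} = [ν′ = ν]·f` (part 42's `suppInL_ten_of_isLoc`), `∇*J = ρ(n(s_ν⁻¹−1))f` (`star_fdiff_mulVec_ofReal`). [cite: Balaban1984PropagatorsI, Prop. 1.2 (1.114) p.36] -/
theorem hasMajL2_gradDivAdj_of_ineq (hn : 1 ≤ n) {K : ℕ} {C δ₀ : ℝ} {Cα Cε : ℝ → ℝ} {Cαε : ℝ → ℝ → ℝ}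
    (H : B5.Ineq110_114 (latticeSettingP12R n M a K) C Cα Cε Cαε δ₀) (hC : 0 ≤ C) (μ ν : Fin (d + 1)) :
    HasMaj (BlockNorm.l2Blocks (unitTorusGeo L k M) (fun i : Tor (fine n M) × Fin (d + 1) => blockOf n M i.1) (etaPow n (d + 1)) (etaPow_nonneg _ _))
      (BlockNorm.l2Blocks (unitTorusGeo L k M) (fun i : Tor (fine n M) × Fin (d + 1) => blockOf n M i.1) (etaPow n (d + 1)) (etaPow_nonneg _ _))
      (symbOp M n (sD M n μ n) ∘ₗ gOp M n a ∘ₗ symbOp M n ((n : ℝ) • (sTinv M n ν - 1))) (fun y y' => C * Real.exp (-(δ₀ * tdistT M y y'))) := by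
  classical
  intro y' f hf y
  set b := BlockNorm.l2Blocks (unitTorusGeo L k M) (fun i : Tor (fine n M) × Fin (d + 1) => blockOf n M i.1) (etaPow n (d + 1)) (etaPow_nonneg _ _) with hb
  set Jt : LocR n M := LocR.ten fun ν' => if ν' = ν then f else 0 with hJt
  have hsupp : suppInL n M Jt.emb y' := suppInL_ten_of_isLoc M k n hn ν hf
  have h114 := H.2.2.2.2 3 Jt (blockCut M n y) y y' (cutInL_blockCut M n hn y) hsupp
  have hdiv : divT n M (fun s b' => (((if s = ν then f else 0) b' : ℝ) : ℂ)) = fun i => ((symbOp M n ((n : ℝ) • (sTinv M n ν - 1)) f i : ℝ) : ℂ) := by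
    rw [divT, Finset.sum_eq_single ν (fun s _ hs => by
        rw [show (fun b' => (((if s = ν then f else 0) b' : ℝ) : ℂ)) = 0 from funext fun b' => by simp [hs], Matrix.mulVec_zero])
      (fun h => absurd (Finset.mem_univ ν) h)]
    funext i
    rw [show (fun b' => (((if ν = ν then f else 0) b' : ℝ) : ℂ)) = fun b' => ((f b' : ℝ) : ℂ) from funext fun b' => by simp, star_fdiff_mulVec_ofReal]
  have hgrad : grad n M ((DeltaA n M a)⁻¹ *ᵥ divT n M (fun s b' => (((if s = ν then f else 0) b' : ℝ) : ℂ))) μ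
      = fun b => (((symbOp M n (sD M n μ n) ∘ₗ gOp M n a ∘ₗ symbOp M n ((n : ℝ) • (sTinv M n ν - 1))) f b : ℝ) : ℂ) := by
    funext b; rw [grad, hdiv, inv_mulVec_ofReal_eq, fdiff_mulVec_ofReal, LinearMap.comp_apply, LinearMap.comp_apply]
  have hsq : b.loc y ((symbOp M n (sD M n μ n) ∘ₗ gOp M n a ∘ₗ symbOp M n ((n : ℝ) • (sTinv M n ν - 1))) f) ^ 2
      ≤ (sqEta n (d + 1) * l2T (smulT n M (blockCut M n y) (grad n M ((DeltaA n M a)⁻¹ *ᵥ divT n M (fun s b' => (((if s = ν then f else 0) b' : ℝ) : ℂ)))))) ^ 2 := by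
    rw [hb, sq_loc_l2Blocks_eq_nsq M k n _ _ y, mul_pow, sqEta_sq]
    refine mul_le_mul_of_nonneg_left ?_ (etaPow_nonneg _ _)
    have hF : smulT n M (blockCut M n y) (grad n M ((DeltaA n M a)⁻¹ *ᵥ divT n M (fun s b' => (((if s = ν then f else 0) b' : ℝ) : ℂ)))) μ
        = fun b => ((blockCut M n y b.1 : ℝ) : ℂ) * ((((symbOp M n (sD M n μ n) ∘ₗ gOp M n a ∘ₗ symbOp M n ((n : ℝ) • (sTinv M n ν - 1))) f b : ℝ) : ℂ)) := by
      funext b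
      show ((blockCut M n y b.1 : ℝ) : ℂ) * grad n M ((DeltaA n M a)⁻¹ *ᵥ divT n M (fun s b' => (((if s = ν then f else 0) b' : ℝ) : ℂ))) μ b = _
      rw [hgrad]
    rw [← hF]
    exact nsq_le_l2T_sq _ μ
  -- the source norm: only the slot `ν` is non-zero
  have hN : sqEta n (d + 1) * locNorm Jt.emb = b.loc y' f := by
    rw [hb, ← sqEta_mul_l2_eq_loc M k n hf]
    congr 1
    show l2T (fun s b' => (((if s = ν then f else 0) b' : ℝ) : ℂ)) = l2 (fun b : Tor (fine n M) × Fin (d + 1) => ((f b : ℝ) : ℂ))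
    rw [l2T, l2, Finset.sum_eq_single ν (fun s _ hs => by simp [hs, nsq]) (fun h => absurd (Finset.mem_univ ν) h)]
    simp
  refine loc_le_of_l2loc M k n hC (mul_nonneg (sqEta_nonneg _ _) (by unfold l2T; exact Real.sqrt_nonneg _))
    (cutSupL_blockCut_le M n y) hN hsq ?_
  have e : (latticeSettingP12R n M a K).l2loc 3 Jt (blockCut M n y)
      = sqEta n (d + 1) * l2T (smulT n M (blockCut M n y) (grad n M ((DeltaA n M a)⁻¹ *ᵥ divT n M (fun s b' => (((if s = ν then f else 0) b' : ℝ) : ℂ))))) := rfl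
  rw [← e, ← distSite_eq_tdistT]
  exact h114

/-- ★ **(1.114) ENTRY «∇∇GJ» IN L²-BLOCK CURRENCY (generic)**: `HasMaj (l2Blocks η^D) (l2Blocks η^D) (ρ(sD_μ n)∘ρ(sD_ν n)∘G) (C·e^{−δ₀ tdistT})`. [cite: Balaban1984PropagatorsI, Prop. 1.2 (1.114) p.36] -/
theorem hasMajL2_grad2_of_ineq (hn : 1 ≤ n) {K : ℕ} {C δ₀ : ℝ} {Cα Cε : ℝ → ℝ} {Cαε : ℝ → ℝ → ℝ}
    (H : B5.Ineq110_114 (latticeSettingP12R n M a K) C Cα Cε Cαε δ₀) (hC : 0 ≤ C) (μ ν : Fin (d + 1)) :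
    HasMaj (BlockNorm.l2Blocks (unitTorusGeo L k M) (fun i : Tor (fine n M) × Fin (d + 1) => blockOf n M i.1) (etaPow n (d + 1)) (etaPow_nonneg _ _))
      (BlockNorm.l2Blocks (unitTorusGeo L k M) (fun i : Tor (fine n M) × Fin (d + 1) => blockOf n M i.1) (etaPow n (d + 1)) (etaPow_nonneg _ _))
      (symbOp M n (sD M n μ n) ∘ₗ symbOp M n (sD M n ν n) ∘ₗ gOp M n a) (fun y y' => C * Real.exp (-(δ₀ * tdistT M y y'))) := by
  classical
  intro y' f hf y
  set b := BlockNorm.l2Blocks (unitTorusGeo L k M) (fun i : Tor (fine n M) × Fin (d + 1) => blockOf n M i.1) (etaPow n (d + 1)) (etaPow_nonneg _ _) with hb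
  have hsupp : suppInL n M (LocR.vec f).emb y' := suppInL_vec_of_isLoc M k n hn hf
  have h114 := H.2.2.2.2 4 (LocR.vec f) (blockCut M n y) y y' (cutInL_blockCut M n hn y) hsupp
  have hG : ((DeltaA n M a)⁻¹ *ᵥ fun i => ((f i : ℝ) : ℂ)) = fun i => ((gOp M n a f i : ℝ) : ℂ) := inv_mulVec_ofReal_eq M n a f
  have hD : (fdiff (fine n M) ((n : ℕ) : ℂ) ν *ᵥ fun i => ((gOp M n a f i : ℝ) : ℂ)) = fun i => ((symbOp M n (sD M n ν n) (gOp M n a f) i : ℝ) : ℂ) :=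
    funext fun i => fdiff_mulVec_ofReal M n ν _ i
  have hgrad2 : grad2 n M ((DeltaA n M a)⁻¹ *ᵥ fun i => ((f i : ℝ) : ℂ)) (μ, ν)
      = fun b => (((symbOp M n (sD M n μ n) ∘ₗ symbOp M n (sD M n ν n) ∘ₗ gOp M n a) f b : ℝ) : ℂ) := by
    funext b; rw [grad2, hG, hD, fdiff_mulVec_ofReal, LinearMap.comp_apply, LinearMap.comp_apply]
  have hsq : b.loc y ((symbOp M n (sD M n μ n) ∘ₗ symbOp M n (sD M n ν n) ∘ₗ gOp M n a) f) ^ 2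
      ≤ (sqEta n (d + 1) * l2T (smulT n M (blockCut M n y) (grad2 n M ((DeltaA n M a)⁻¹ *ᵥ fun i => ((f i : ℝ) : ℂ))))) ^ 2 := by
    rw [hb, sq_loc_l2Blocks_eq_nsq M k n _ _ y, mul_pow, sqEta_sq]
    refine mul_le_mul_of_nonneg_left ?_ (etaPow_nonneg _ _)
    have hF : smulT n M (blockCut M n y) (grad2 n M ((DeltaA n M a)⁻¹ *ᵥ fun i => ((f i : ℝ) : ℂ))) (μ, ν)
        = fun b => ((blockCut M n y b.1 : ℝ) : ℂ) * ((((symbOp M n (sD M n μ n) ∘ₗ symbOp M n (sD M n ν n) ∘ₗ gOp M n a) f b : ℝ) : ℂ)) := by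
      funext b
      show ((blockCut M n y b.1 : ℝ) : ℂ) * grad2 n M ((DeltaA n M a)⁻¹ *ᵥ fun i => ((f i : ℝ) : ℂ)) (μ, ν) b = _
      rw [hgrad2]
    rw [← hF]
    exact nsq_le_l2T_sq _ (μ, ν)
  refine loc_le_of_l2loc M k n hC (mul_nonneg (sqEta_nonneg _ _) (by unfold l2T; exact Real.sqrt_nonneg _))
    (cutSupL_blockCut_le M n y) (sqEta_mul_l2_eq_loc M k n hf) hsq ?_
  have e : (latticeSettingP12R n M a K).l2loc 4 (LocR.vec f) (blockCut M n y)
      = sqEta n (d + 1) * l2T (smulT n M (blockCut M n y) (grad2 n M ((DeltaA n M a)⁻¹ *ᵥ fun i => ((f i : ℝ) : ℂ)))) := rfl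
  rw [← e, ← distSite_eq_tdistT]
  exact h114

/-- the DOUBLE-TENSOR source `J_p = [p = (μ,ν)]·f` of a block-localised `f`: `supp ⊂ Δ̃(y′)`. [cite: Balaban1984PropagatorsI, Prop. 1.2 (1.114) p.36 (supp J ⊂ Δ̃(y′))] -/
theorem suppInL_ten2_of_isLoc (hn : 1 ≤ n) (μ ν : Fin (d + 1)) {f : Tor (fine n M) × Fin (d + 1) → ℝ} {y' : Tor M}
    (hf : (BlockNorm.ofBlocks (unitTorusGeo L k M) (fun i : Tor (fine n M) × Fin (d + 1) => blockOf n M i.1)).IsLoc y' f) :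
    suppInL n M (LocR.ten2 fun p : Fin (d + 1) × Fin (d + 1) => if p = (μ, ν) then f else 0).emb y' := by
  intro p b hb
  have hby : blockOf n M b.1 = y' := by
    by_contra h
    refine hb ?_
    show (((if p = (μ, ν) then f else 0) b : ℝ) : ℂ) = 0
    split_ifs
    · rw [hf b h, Complex.ofReal_zero]
    · rw [Pi.zero_apply, Complex.ofReal_zero]
  rw [← hby]
  exact mem_cubeT_blockOf M n hn b.1

/-- the double divergence of the embedded one-slot source `J_p = [p = (μ,ν)]·f` is the embedded `ρ(n(s_μ⁻¹−1))ρ(n(s_ν⁻¹−1))f`. [cite: Balaban1984PropagatorsI, (1.89) p.33] -/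
theorem divT2_oneSlot_ofReal (μ ν : Fin (d + 1)) (f : Tor (fine n M) × Fin (d + 1) → ℝ) :
    divT2 n M (fun p b' => (((if p = (μ, ν) then f else 0) b' : ℝ) : ℂ))
      = fun i => ((symbOp M n ((n : ℝ) • (sTinv M n μ - 1)) (symbOp M n ((n : ℝ) • (sTinv M n ν - 1)) f) i : ℝ) : ℂ) := by
  rw [divT2, Finset.sum_eq_single (μ, ν) (fun p _ hp => by
      rw [show (fun b' => (((if p = (μ, ν) then f else 0) b' : ℝ) : ℂ)) = 0 from funext fun b' => by simp [hp], Matrix.mulVec_zero, Matrix.mulVec_zero])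
    (fun h => absurd (Finset.mem_univ _) h)]
  rw [show (fun b' => (((if ((μ, ν) : Fin (d + 1) × Fin (d + 1)) = (μ, ν) then f else 0) b' : ℝ) : ℂ)) = fun b' => ((f b' : ℝ) : ℂ) from funext fun b' => by simp,
    show (star (fdiff (fine n M) ((n : ℕ) : ℂ) ((μ, ν) : Fin (d + 1) × Fin (d + 1)).2) *ᵥ fun b' => ((f b' : ℝ) : ℂ))
        = fun i => ((symbOp M n ((n : ℝ) • (sTinv M n ν - 1)) f i : ℝ) : ℂ) from funext fun i => star_fdiff_mulVec_ofReal M n ν f i]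
  exact funext fun i => star_fdiff_mulVec_ofReal M n μ _ i

/-- ★ **(1.114) ENTRY «G∇*∇*J» IN L²-BLOCK CURRENCY (generic)**: `HasMaj (l2Blocks η^D) (l2Blocks η^D) (G∘ρ(n(s_μ⁻¹−1))∘ρ(n(s_ν⁻¹−1))) (C·e^{−δ₀ tdistT})` — BOTH derivatives on the
rough source: the sixth entry of (1.114), source `J_p = [p = (μ,ν)]·f`. [cite: Balaban1984PropagatorsI, Prop. 1.2 (1.114) p.36] -/
theorem hasMajL2_divAdj2_of_ineq (hn : 1 ≤ n) {K : ℕ} {C δ₀ : ℝ} {Cα Cε : ℝ → ℝ} {Cαε : ℝ → ℝ → ℝ}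
    (H : B5.Ineq110_114 (latticeSettingP12R n M a K) C Cα Cε Cαε δ₀) (hC : 0 ≤ C) (μ ν : Fin (d + 1)) :
    HasMaj (BlockNorm.l2Blocks (unitTorusGeo L k M) (fun i : Tor (fine n M) × Fin (d + 1) => blockOf n M i.1) (etaPow n (d + 1)) (etaPow_nonneg _ _))
      (BlockNorm.l2Blocks (unitTorusGeo L k M) (fun i : Tor (fine n M) × Fin (d + 1) => blockOf n M i.1) (etaPow n (d + 1)) (etaPow_nonneg _ _))
      (gOp M n a ∘ₗ symbOp M n ((n : ℝ) • (sTinv M n μ - 1)) ∘ₗ symbOp M n ((n : ℝ) • (sTinv M n ν - 1))) (fun y y' => C * Real.exp (-(δ₀ * tdistT M y y'))) := by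
  classical
  intro y' f hf y
  set b := BlockNorm.l2Blocks (unitTorusGeo L k M) (fun i : Tor (fine n M) × Fin (d + 1) => blockOf n M i.1) (etaPow n (d + 1)) (etaPow_nonneg _ _) with hb
  set J2 : LocR n M := LocR.ten2 fun p : Fin (d + 1) × Fin (d + 1) => if p = (μ, ν) then f else 0 with hJ2
  have hsupp : suppInL n M J2.emb y' := suppInL_ten2_of_isLoc M k n hn μ ν hf
  have h114 := H.2.2.2.2 5 J2 (blockCut M n y) y y' (cutInL_blockCut M n hn y) hsupp
  have hG : ((DeltaA n M a)⁻¹ *ᵥ divT2 n M (fun p b' => (((if p = (μ, ν) then f else 0) b' : ℝ) : ℂ)))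
      = fun i => (((gOp M n a ∘ₗ symbOp M n ((n : ℝ) • (sTinv M n μ - 1)) ∘ₗ symbOp M n ((n : ℝ) • (sTinv M n ν - 1))) f i : ℝ) : ℂ) := by
    rw [divT2_oneSlot_ofReal, inv_mulVec_ofReal_eq]
    rfl
  have hsq : b.loc y ((gOp M n a ∘ₗ symbOp M n ((n : ℝ) • (sTinv M n μ - 1)) ∘ₗ symbOp M n ((n : ℝ) • (sTinv M n ν - 1))) f) ^ 2
      ≤ (sqEta n (d + 1) * l2 (smulV n M (blockCut M n y) ((DeltaA n M a)⁻¹ *ᵥ divT2 n M (fun p b' => (((if p = (μ, ν) then f else 0) b' : ℝ) : ℂ))))) ^ 2 := by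
    rw [hb, sq_loc_l2Blocks_eq_nsq M k n _ _ y, mul_pow, sqEta_sq, l2, Real.sq_sqrt (B5Prop11Lower.nsq_nonneg _), hG]
    rfl
  have hN : sqEta n (d + 1) * locNorm J2.emb = b.loc y' f := by
    rw [hb, ← sqEta_mul_l2_eq_loc M k n hf]
    congr 1
    show l2T (fun p b' => (((if p = (μ, ν) then f else 0) b' : ℝ) : ℂ)) = l2 (fun b : Tor (fine n M) × Fin (d + 1) => ((f b : ℝ) : ℂ))
    rw [l2T, l2, Finset.sum_eq_single (μ, ν) (fun p _ hp => by simp [hp, nsq]) (fun h => absurd (Finset.mem_univ _) h)]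
    simp
  refine loc_le_of_l2loc M k n hC (mul_nonneg (sqEta_nonneg _ _) (by unfold l2; exact Real.sqrt_nonneg _))
    (cutSupL_blockCut_le M n y) hN hsq ?_
  have e : (latticeSettingP12R n M a K).l2loc 5 J2 (blockCut M n y)
      = sqEta n (d + 1) * l2 (smulV n M (blockCut M n y) ((DeltaA n M a)⁻¹ *ᵥ divT2 n M (fun p b' => (((if p = (μ, ν) then f else 0) b' : ℝ) : ℂ)))) := rfl
  rw [← e, ← distSite_eq_tdistT]
  exact h114

end Entries

/-! ## §84 ★ The η-pair of record: L² majorants of `∇G`, `∇G∇*`, `∇∇G` on both members, one constant pair -/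

section Pair

variable {L : ℕ} [NeZero L]

/-- ★ **(1.114) ON BOTH MEMBERS OF THE η-PAIR OF RECORD, L²-BLOCK CURRENCY**: for odd `L > 1`, `a > 0` there are `δ₀, C > 0` such that for every torus exponent `m_T`, every `k ≥ 1`, every
refinement `m` and all directions `μ, ν`, on the coarse member (`n = L^k`) and on the fine member (`n′ = L^m·L^k`), the operators `∇_μG`, `∇_μG∇*_ν`, `∇_μ∇_νG` have the (L² → L²) block
majorant `C·e^{−δ₀|y−y′|_T}` (weight `η^{d+1}`, King unit blocks).  `prop12_famG_printed` through `ineq110_114_pair` and §83. [cite: Balaban1984PropagatorsI, Prop. 1.2 (1.114) p.36] -/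
theorem hasMajL2_entries114_pair (hL : Odd L ∧ 1 < L) {a : ℝ} (ha : 0 < a) :
    ∃ δ₀ C : ℝ, 0 < δ₀ ∧ 0 < C ∧ ∀ (mT k m : ℕ) (hk : 1 ≤ k) (μ ν : Fin (d + 1)),
      (∀ n ∈ ({L ^ k, L ^ m * L ^ k} : Finset ℕ), ∀ hn : NeZero n,
        HasMaj (BlockNorm.l2Blocks (unitTorusGeo L k (MP (paramsOf d L mT k hL))) (fun i : Tor (fine n (MP (paramsOf d L mT k hL))) × Fin (d + 1) => blockOf n (MP (paramsOf d L mT k hL)) i.1)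
            (etaPow n (d + 1)) (etaPow_nonneg _ _))
          (BlockNorm.l2Blocks (unitTorusGeo L k (MP (paramsOf d L mT k hL))) (fun i : Tor (fine n (MP (paramsOf d L mT k hL))) × Fin (d + 1) => blockOf n (MP (paramsOf d L mT k hL)) i.1)
            (etaPow n (d + 1)) (etaPow_nonneg _ _))
          (symbOp (MP (paramsOf d L mT k hL)) n (sD (MP (paramsOf d L mT k hL)) n μ n) ∘ₗ gOp (MP (paramsOf d L mT k hL)) n a)
          (fun y y' => C * Real.exp (-(δ₀ * tdistT (MP (paramsOf d L mT k hL)) y y'))) ∧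
        HasMaj (BlockNorm.l2Blocks (unitTorusGeo L k (MP (paramsOf d L mT k hL))) (fun i : Tor (fine n (MP (paramsOf d L mT k hL))) × Fin (d + 1) => blockOf n (MP (paramsOf d L mT k hL)) i.1)
            (etaPow n (d + 1)) (etaPow_nonneg _ _))
          (BlockNorm.l2Blocks (unitTorusGeo L k (MP (paramsOf d L mT k hL))) (fun i : Tor (fine n (MP (paramsOf d L mT k hL))) × Fin (d + 1) => blockOf n (MP (paramsOf d L mT k hL)) i.1)
            (etaPow n (d + 1)) (etaPow_nonneg _ _))
          (symbOp (MP (paramsOf d L mT k hL)) n (sD (MP (paramsOf d L mT k hL)) n μ n) ∘ₗ gOp (MP (paramsOf d L mT k hL)) n a ∘ₗ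
            symbOp (MP (paramsOf d L mT k hL)) n ((n : ℝ) • (sTinv (MP (paramsOf d L mT k hL)) n ν - 1)))
          (fun y y' => C * Real.exp (-(δ₀ * tdistT (MP (paramsOf d L mT k hL)) y y'))) ∧
        HasMaj (BlockNorm.l2Blocks (unitTorusGeo L k (MP (paramsOf d L mT k hL))) (fun i : Tor (fine n (MP (paramsOf d L mT k hL))) × Fin (d + 1) => blockOf n (MP (paramsOf d L mT k hL)) i.1)
            (etaPow n (d + 1)) (etaPow_nonneg _ _))
          (BlockNorm.l2Blocks (unitTorusGeo L k (MP (paramsOf d L mT k hL))) (fun i : Tor (fine n (MP (paramsOf d L mT k hL))) × Fin (d + 1) => blockOf n (MP (paramsOf d L mT k hL)) i.1)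
            (etaPow n (d + 1)) (etaPow_nonneg _ _))
          (symbOp (MP (paramsOf d L mT k hL)) n (sD (MP (paramsOf d L mT k hL)) n μ n) ∘ₗ symbOp (MP (paramsOf d L mT k hL)) n (sD (MP (paramsOf d L mT k hL)) n ν n) ∘ₗ
            gOp (MP (paramsOf d L mT k hL)) n a)
          (fun y y' => C * Real.exp (-(δ₀ * tdistT (MP (paramsOf d L mT k hL)) y y')))) := by
  obtain ⟨δ₀, C, Cα, Cε, Cαε, hδ₀, hC, HP⟩ := ineq110_114_pair (d := d) hL ha
  refine ⟨δ₀, C, hδ₀, hC, fun mT k m hk μ ν n hn hne => ?_⟩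
  have hL0 : 0 < L := Nat.pos_of_ne_zero (NeZero.ne L)
  rw [Finset.mem_insert, Finset.mem_singleton] at hn
  rcases hn with rfl | rfl
  · have hn1 : 1 ≤ L ^ k := Nat.one_le_pow _ _ hL0
    exact ⟨hasMajL2_grad_of_ineq _ k _ a hn1 (HP mT k m hk).1 hC.le μ, hasMajL2_gradDivAdj_of_ineq _ k _ a hn1 (HP mT k m hk).1 hC.le μ ν,
      hasMajL2_grad2_of_ineq _ k _ a hn1 (HP mT k m hk).1 hC.le μ ν⟩
  · have hn1 : 1 ≤ L ^ m * L ^ k := Nat.one_le_iff_ne_zero.mpr (Nat.mul_ne_zero (pow_ne_zero m (NeZero.ne L)) (pow_ne_zero k (NeZero.ne L)))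
    exact ⟨hasMajL2_grad_of_ineq _ k _ a hn1 (HP mT k m hk).2 hC.le μ, hasMajL2_gradDivAdj_of_ineq _ k _ a hn1 (HP mT k m hk).2 hC.le μ ν,
      hasMajL2_grad2_of_ineq _ k _ a hn1 (HP mT k m hk).2 hC.le μ ν⟩

end Pair

end Summit.QuantumFields.YangMills.BalabanUVNodes.N15.TwoGrid
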